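import Summits.QuantumFields.YangMills.Theorems.BalabanUVNodesK1WindowExactCriterion

/-!
# Crux K1⁷ — THE `K ≥ 1` WINDOW: GERM DEPENDENCE, SHARPNESS WITNESSES FOR THE EXACT CRITERION, AND THE K-INDEXED WINDOW FROM THE EXACT LEVEL-0 CRITERION
# PLUS UPPER BOX BOUNDS AT LEVELS `k ≥ 1` ONLY (flow side; at NODE 00's Stage-13 datum `Node00.datumOfRecord₁₃SepCoPH F N θ h`)

Cell `pub-ymgap`, YM-PLAN Track A (HUMAN RULING D-0062 ∕ D-0149, director-ym №197), WIDTH SEAT `pub-ymgap-dag-n13-w4` (g2) on NODE n13 [Balaban1989LargeFieldII]; helper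
(`--supports`) for crux K1⁷ `StabilityBAtRecordR13SepCoPH` = stmt-QuantumFields-20542 (plan g73 rev 24∕25; skeleton v5 38c62055d1ac34a4).  THIRD g2 storey of W-SEAT-START-LIST §1 n13
ITEM 4 = n24 ITEM 2 (the `Window` clause; one declarer: this seat — g0 `…K1WindowFirstStep` ∕ `…N13WindowAtRecord13SepCoPH`, g2 `…K1WindowExactCriterion` ∕ `…K1WindowBite`).  COUNT-NEUTRAL.

WHY THIS FILE.  `…K1WindowExactCriterion` settled: for a generated flow (and at the record, `0 < θ.γ`) the `K ≥ 1` window HOLDS IFF `∀ M, ∃ᶠ g in 𝓝[>] 0, M ≤ g⁻² − β 0 (g)`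
(«`g⁻² − β 0` is not eventually bounded above at `0⁺`»).  Three consequences are recorded here.
(1) GERM DEPENDENCE: the window reads only the GERM AT `0⁺` of the first β-function — two history families whose first β-functions agree eventually at `0⁺` have the same
window; at the record the window of `(θ, h)` depends on `θ` only through `θ.toStage13Params` (NOT on the proviso witness `h`, NOT on the history-indexed slots `Zh ∕ Phih` of
`Stage13HParams`), and, finer, only through the germ of the merged first β-function `β_m 0` at `0⁺`.
(2) SHARPNESS: the exact criterion lies STRICTLY between the two one-sided forms of record — kernel witnesses on the abstract flow side (MODELS of `FlowStep.HBeta`, NOT Bałaban's β):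
`β_c 0 (g) := g⁻² − 1` satisfies ROW W12's ∕ g0's NECESSARY form «`g²β 0 (g) < 1`» at EVERY `g > 0` and yet its window FAILS (`g⁻² − β_c 0 (g) = 1` is bounded); `β_d 0 (g) := g⁻² − g⁻¹`
violates g0's SUFFICIENT form «`∃ c < 1, ∃ᶠ g, g²β 0 (g) ≤ c`» (`g²β_d 0 (g) = 1 − g → 1⁻`) and is not even frequently bounded above, and yet its window HOLDS (`g⁻² − β_d 0 (g) = g⁻¹ → ∞`).
So neither one-sided form of record is the criterion; K1⁷'s window can hold with `g²β_m → 1⁻` and can fail with `g²β_m < 1` everywhere.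
(3) THE K-INDEXED WINDOW (runs of EVERY length `K` inside `]0, γ]`, the shape K2⁷'s `EndpointExistence` and the continuum direction need) from the EXACT level-0 criterion PLUS an
upper box bound `β k (v) ≤ β⁺` on `]0, γ₀]^{k+1}` at the levels `k ≥ 1` ONLY — dag-n24-a's `Node00.N24_window_allK_of_forwardGenerated` asks the upper bound at EVERY level including
`k = 0`; here level `0` is weakened to the exact criterion (a first β-function unbounded above near `0⁺` is tolerated as long as `g⁻² − β 0 (g)` is unbounded above too): pick the
bare coupling `g₀ ∈ ]0, γ]` with `g₀⁻² − β 0 (g₀) ≥ γ⁻² + K·max(β⁺,0)` (frequently available), then (0.20) loses at most `max(β⁺,0)` per later step.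

WHAT THIS FILE PROVES (theorems only, 0 `def`, 0 `sorry`).
* §1 GERM DEPENDENCE: `firstStep_congr_of_eventuallyEq` · `window_genSeq_congr_of_eventuallyEq` (flow side); at the record `window_datumOfRecord₁₃SepCoPH_congr_toStage13Params` (no
  hypothesis: same `toStage13Params` ⟹ same window — `h`, `Zh`, `Phih` unread) · ★ `window_datumOfRecord₁₃SepCoPH_congr_of_eventuallyEq_merged` (`0 < θ.γ`, `0 < θ'.γ`, merged first
  β-functions eventually equal at `0⁺` ⟹ same window).
* §2 SHARPNESS WITNESSES (flow-side MODELS): `eventually_le_one_div_nhdsGT` · ★ `not_window_genSeq_invSq_sub_one` with `sq_mul_invSq_sub_one_lt_one` ∕ `necessaryForm_invSq_sub_one`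
  (necessary form of record holds, window fails) · ★ `window_genSeq_invSq_sub_inv` with `not_sufficientForm_invSq_sub_inv` ∕ `not_frequently_le_invSq_sub_inv` (sufficient forms of
  record fail, window holds).
* §3 K-INDEXED WINDOW: ★★ `ladder_of_forwardGenerated_of_firstStepGap_of_betaUpper_succ` (the inductive bound) · ★★ `windowK_of_forwardGenerated_of_frequently_le_of_betaUpper_succ`
  (every `K`, `m`, `γ ∈ ]0, γ₀]`) · `windowK_of_frequently_le_of_betaUpper_succ` (any `FiniteEpsData`); at the record `betaOfRecord₁₃_eq_betaMerged_of_mem_box` (face: ON the box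
  `]0, θ.γ]^{k+1}` the β of record IS the merged β, every level) · ★★ `windowK_datumOfRecord₁₃SepCoPH_of_frequently_le_merged_of_betaMerged_upper_succ`.

HONEST SCOPE (A6, №189).  Elementary filter∕order∕induction bookkeeping on real sequences; §2's families are MODELS on the abstract flow side (junk β's exhibiting strictness), NOT
Bałaban's β-functions; every β-input of §3 at the record is DISPLAYED (NODE O's: the level-0 germ condition and [I] p. 264's «uniformly bounded» at the levels `k ≥ 1`), none
discharged; `(θ, h : θ.Provisos₁₃SepCoPH F N)` is inhabited iff K0⁷ `Record13SepCoPHInhabited` (open crux stmt-QuantumFields-20541).  Nothing of Bałaban's analysis is asserted or used;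
N13 NOT discharged; K1⁷ ∕ K2⁷ NOT closed; no stub closed; counts unmoved (typed 28∕28 · discharged 5∕27 · A 5∕28).  One finite four-torus programme at fixed `ε = L^{−K}`, Bałaban AS
PRINTED; the YM mass gap (Clay) is NOT proved by any of this — R4 closes the conditional finite-𝕋⁴ rung `BalabanLadder.UV` only; nothing continuum ∕ ℝ⁴ ∕ OS.  No `def`, no `instance`,
no `notation`, no `axiom`.
References: [I] = [Balaban1987RG1] CMP **109** (1987): (0.17)–(0.20) pp. 255–256, Thm 2 p. 259, (1.20)–(1.22) p. 264, (2.9) p. 266, (2.12)–(2.14) p. 268; [B16] = [Balaban1989LargeFieldII]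
CMP **122** (1989): Thm 1 + (0.1) pp. 355–356.
-/

noncomputable section

open scoped Matrix.Norms.L2Operator

namespace Summit.QuantumFields.YangMills.Theorems.BalabanUVNodesK1WindowSharpness

open Literature.MathematicalPhysics.QuantumFieldTheory.Balaban1983to89
open Literature.MathematicalPhysics.QuantumFieldTheory.Balaban1983to89.FlowStep
open Literature.MathematicalPhysics.QuantumFieldTheory.Balaban1983to89.FlowStepRuns
open Literature.MathematicalPhysics.QuantumFieldTheory.Balaban1983to89.DagBinding
open Literature.MathematicalPhysics.QuantumFieldTheory.Balaban1983to89.T4Continuum (T4Family FiniteEpsData)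
open Literature.MathematicalPhysics.QuantumFieldTheory.Balaban1983to89.Node00
open Summit.QuantumFields.YangMills.Theorems.BalabanUVNodesK1WindowFirstStep
open Summit.QuantumFields.YangMills.Theorems.BalabanUVNodesN13WindowAtRecord13SepCoPH
open Summit.QuantumFields.YangMills.Theorems.BalabanUVNodesK1WindowExactCriterion
open Filter Topology

/-! ## §1. Germ dependence: the window reads only the germ at `0⁺` of the first β-function -/

section Germ

/-- **The first-step condition depends only on the GERM of the first β-function at `0⁺`**: two history families whose first β-functions agree eventually at `0⁺` satisfy ROW W12's
first-step condition simultaneously (`firstStep_iff_frequently_le` + `Filter.frequently_congr`). [cite: Balaban1987RG1, (0.18)–(0.20) pp.255–256 and §1 p.264 (elementary)] -/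
theorem firstStep_congr_of_eventuallyEq (β β' : HBeta) (heq : ∀ᶠ x in 𝓝[>] (0 : ℝ), β 0 (fun _ => x) = β' 0 (fun _ => x)) :
    (∃ γ₁ : ℝ, 0 < γ₁ ∧ ∀ γ : ℝ, 0 < γ → γ ≤ γ₁ →
        ∃ g0 : ℝ, (0 < g0 ∧ g0 ≤ γ) ∧ β 0 (fun _ => g0) ≤ 1 / g0 ^ 2 - 1 / γ ^ 2) ↔
      ∃ γ₁ : ℝ, 0 < γ₁ ∧ ∀ γ : ℝ, 0 < γ → γ ≤ γ₁ →
        ∃ g0 : ℝ, (0 < g0 ∧ g0 ≤ γ) ∧ β' 0 (fun _ => g0) ≤ 1 / g0 ^ 2 - 1 / γ ^ 2 := by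
  rw [firstStep_iff_frequently_le β, firstStep_iff_frequently_le β']
  refine forall_congr' fun M => Filter.frequently_congr ?_
  filter_upwards [heq] with x hx
  rw [hx]

/-- **The window of a generated flow depends only on the germ of the first β-function at `0⁺`.** [cite: Balaban1987RG1, (0.17)–(0.20) pp.255–256 and §1 p.264 (elementary)] -/
theorem window_genSeq_congr_of_eventuallyEq (β β' : HBeta) (heq : ∀ᶠ x in 𝓝[>] (0 : ℝ), β 0 (fun _ => x) = β' 0 (fun _ => x)) :
    (∃ γ₁ : ℝ, 0 < γ₁ ∧ ∀ γ : ℝ, 0 < γ → γ ≤ γ₁ → ∃ P : B12.RunParams, 1 ≤ P.K ∧ Step.InInterval γ P.K (genSeq β P.g0)) ↔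
      ∃ γ₁ : ℝ, 0 < γ₁ ∧ ∀ γ : ℝ, 0 < γ → γ ≤ γ₁ → ∃ P : B12.RunParams, 1 ≤ P.K ∧ Step.InInterval γ P.K (genSeq β' P.g0) := by
  rw [window_genSeq_iff β, window_genSeq_iff β']
  exact firstStep_congr_of_eventuallyEq β β' heq

variable {F : T4Family} {N : ℕ} [NeZero N]

/-- **AT THE RECORD THE WINDOW READS `θ.toStage13Params` ONLY** (no hypothesis): two history-indexed tuples `θ, θ' : Stage13HParams F N` with the same Stage-13 parameters have the
same window at their data of record, WHATEVER their proviso witnesses `h, h'` and their history-indexed residual slots `Zh ∕ Phih` (the flow of the datum is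
`genSeq (betaOfRecord₁₃ F N θ.toStage13Params) P.g0`, def-T's `flow_g_datumOfRecord₁₃SepCoPH`). [cite: Balaban1987RG1, (0.17)–(0.20) pp.255–256 and (1.20)–(1.22) p.264; Balaban1989LargeFieldII, Thm 1 + (0.1) pp.355–356 (bookkeeping)] -/
theorem window_datumOfRecord₁₃SepCoPH_congr_toStage13Params (θ θ' : Stage13HParams F N) (h : θ.Provisos₁₃SepCoPH F N) (h' : θ'.Provisos₁₃SepCoPH F N)
    (he : θ.toStage13Params = θ'.toStage13Params) :
    (∃ γ₁ : ℝ, 0 < γ₁ ∧ ∀ γ : ℝ, 0 < γ → γ ≤ γ₁ →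
        ∃ P : B12.RunParams, 1 ≤ P.K ∧ ((datumOfRecord₁₃SepCoPH F N θ h).C P).flow.InInterval γ P.K) ↔
      ∃ γ₁ : ℝ, 0 < γ₁ ∧ ∀ γ : ℝ, 0 < γ → γ ≤ γ₁ →
        ∃ P : B12.RunParams, 1 ≤ P.K ∧ ((datumOfRecord₁₃SepCoPH F N θ' h').C P).flow.InInterval γ P.K := by
  rw [window_datumOfRecord₁₃SepCoPH_iff_firstBeta θ h, window_datumOfRecord₁₃SepCoPH_iff_firstBeta θ' h', he]

/-- ★ **AT THE RECORD THE WINDOW READS ONLY THE GERM OF THE MERGED FIRST β-FUNCTION AT `0⁺`** (`0 < θ.γ`, `0 < θ'.γ`): if the merged first β-functions of `θ` and `θ'` agree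
eventually at `0⁺`, the windows at their data of record are equivalent — every other numeral, object, proviso witness and residual slot is unread.
[cite: Balaban1987RG1, (0.17)–(0.20) pp.255–256, (1.20)–(1.22) p.264 and (2.9) p.266; Balaban1989LargeFieldII, Thm 1 + (0.1) pp.355–356 (bookkeeping)] -/
theorem window_datumOfRecord₁₃SepCoPH_congr_of_eventuallyEq_merged (θ θ' : Stage13HParams F N) (h : θ.Provisos₁₃SepCoPH F N) (h' : θ'.Provisos₁₃SepCoPH F N)
    (hγθ : 0 < θ.γ) (hγθ' : 0 < θ'.γ)
    (heq : ∀ᶠ x in 𝓝[>] (0 : ℝ),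
      (letI := θ.instVβ₁; letI := θ.instVβ₂; letI := θ.instιβ
       betaMerged F (mergedTermFamilyMatT F N (TcanOfRecord F N) (chiβOfRecord₁₃ F N θ.toStage13Params) θ.εbg) θ.ρ8 θ.bV 0 (fun _ => x)) =
      (letI := θ'.instVβ₁; letI := θ'.instVβ₂; letI := θ'.instιβ
       betaMerged F (mergedTermFamilyMatT F N (TcanOfRecord F N) (chiβOfRecord₁₃ F N θ'.toStage13Params) θ'.εbg) θ'.ρ8 θ'.bV 0 (fun _ => x))) :
    (∃ γ₁ : ℝ, 0 < γ₁ ∧ ∀ γ : ℝ, 0 < γ → γ ≤ γ₁ →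
        ∃ P : B12.RunParams, 1 ≤ P.K ∧ ((datumOfRecord₁₃SepCoPH F N θ h).C P).flow.InInterval γ P.K) ↔
      ∃ γ₁ : ℝ, 0 < γ₁ ∧ ∀ γ : ℝ, 0 < γ → γ ≤ γ₁ →
        ∃ P : B12.RunParams, 1 ≤ P.K ∧ ((datumOfRecord₁₃SepCoPH F N θ' h').C P).flow.InInterval γ P.K := by
  rw [window_datumOfRecord₁₃SepCoPH_iff_frequently_le_merged θ h hγθ, window_datumOfRecord₁₃SepCoPH_iff_frequently_le_merged θ' h' hγθ']
  refine forall_congr' fun M => Filter.frequently_congr ?_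
  filter_upwards [heq] with x hx
  rw [hx]

end Germ

/-! ## §2. Sharpness witnesses: the exact criterion lies STRICTLY between the one-sided forms of record (flow-side MODELS, not Bałaban's β) -/

section Sharpness

/-- `g⁻¹` exceeds every level eventually at `0⁺`. [folklore] -/
theorem eventually_le_one_div_nhdsGT (M : ℝ) : ∀ᶠ g in 𝓝[>] (0 : ℝ), M ≤ 1 / g := by
  set M' : ℝ := max M 1 with hM'
  have hM'1 : 1 ≤ M' := le_max_right _ _
  have hM'0 : 0 < M' := lt_of_lt_of_le one_pos hM'1
  have hδ : 0 < 1 / M' := by positivity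
  have hlt : ∀ᶠ g in 𝓝[>] (0 : ℝ), g < 1 / M' := (eventually_lt_nhds hδ).filter_mono nhdsWithin_le_nhds
  have hpos : ∀ᶠ g in 𝓝[>] (0 : ℝ), 0 < g := eventually_mem_nhdsWithin
  filter_upwards [hlt, hpos] with g hg hg0
  have h := one_div_lt_one_div_of_lt hg0 hg
  rw [one_div_one_div] at h
  exact (le_max_left M 1).trans h.le

/-- **WITNESS (c): `β_c 0 (g) := g⁻² − 1` satisfies the NECESSARY form of record at EVERY `g > 0`** — `g² · β_c 0 (g) = 1 − g² < 1` (ROW W12's `sq_mul_betaMerged_lt_one_of_window`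
asks this only along the window's witnesses). A MODEL, not Bałaban's β. [folklore] -/
theorem sq_mul_invSq_sub_one_lt_one {g : ℝ} (hg : 0 < g) :
    g ^ 2 * ((fun (_k : ℕ) (v : Fin (_k + 1) → ℝ) => 1 / (v 0) ^ 2 - 1) 0 (fun _ => g)) < 1 := by
  have hg2 : 0 < g ^ 2 := pow_pos hg 2
  have h1 : g ^ 2 * (1 / g ^ 2) = 1 := by rw [mul_one_div, div_self (ne_of_gt hg2)]
  show g ^ 2 * (1 / g ^ 2 - 1) < 1
  nlinarith

/-- … hence `β_c` satisfies the necessary form in ROW W12's shape at every scale: `∀ γ > 0, ∃ g₀ ∈ ]0, γ], g₀² · β_c 0 (g₀) < 1` (`g₀ := γ`). [folklore] -/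
theorem necessaryForm_invSq_sub_one : ∀ γ : ℝ, 0 < γ →
    ∃ g0 : ℝ, (0 < g0 ∧ g0 ≤ γ) ∧ g0 ^ 2 * ((fun (_k : ℕ) (v : Fin (_k + 1) → ℝ) => 1 / (v 0) ^ 2 - 1) 0 (fun _ => g0)) < 1 :=
  fun γ hγ => ⟨γ, ⟨hγ, le_rfl⟩, sq_mul_invSq_sub_one_lt_one hγ⟩

/-- ★ **… AND YET THE WINDOW OF `β_c` FAILS**: `g⁻² − β_c 0 (g) = 1` is bounded, so by the exact failure mode (`not_window_genSeq_iff_eventually_le`, `M := 1`) the generated flow of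
`β_c` has NO `K ≥ 1` window.  Hence the necessary form of record («`g²β 0 (g) < 1` frequently») is NOT sufficient. A MODEL, not Bałaban's β.
[cite: Balaban1987RG1, (0.17)–(0.20) pp.255–256 (elementary; sharpness of the bookkeeping)] -/
theorem not_window_genSeq_invSq_sub_one :
    ¬ ∃ γ₁ : ℝ, 0 < γ₁ ∧ ∀ γ : ℝ, 0 < γ → γ ≤ γ₁ → ∃ P : B12.RunParams, 1 ≤ P.K ∧
      Step.InInterval γ P.K (genSeq (fun (k : ℕ) (v : Fin (k + 1) → ℝ) => 1 / (v 0) ^ 2 - 1) P.g0) := by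
  rw [not_window_genSeq_iff_eventually_le]
  exact ⟨1, Filter.Eventually.of_forall fun x => le_of_eq rfl⟩

/-- **WITNESS (d): `β_d 0 (g) := g⁻² − g⁻¹` VIOLATES THE SUFFICIENT FORM OF RECORD** «`∃ c < 1, ∃ᶠ g in 𝓝[>] 0, g² · β 0 (g) ≤ c`» (g0's `firstStep_of_frequently_sq_mul_le` ∕
`…_of_sq_mul_le`): `g² · β_d 0 (g) = 1 − g → 1⁻`, so for every `c < 1` eventually `g² · β_d 0 (g) > c`. A MODEL, not Bałaban's β. [folklore] -/
theorem not_sufficientForm_invSq_sub_inv :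
    ¬ ∃ c : ℝ, c < 1 ∧ ∃ᶠ x in 𝓝[>] (0 : ℝ),
      x ^ 2 * ((fun (_k : ℕ) (v : Fin (_k + 1) → ℝ) => 1 / (v 0) ^ 2 - 1 / (v 0)) 0 (fun _ => x)) ≤ c := by
  rintro ⟨c, hc, hfr⟩
  have hlt : ∀ᶠ x in 𝓝[>] (0 : ℝ), x < 1 - c := (eventually_lt_nhds (sub_pos.mpr hc)).filter_mono nhdsWithin_le_nhds
  have hpos : ∀ᶠ x in 𝓝[>] (0 : ℝ), 0 < x := eventually_mem_nhdsWithin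
  obtain ⟨x, hx, hxlt, hx0⟩ := (hfr.and_eventually (hlt.and hpos)).exists
  have hval : x ^ 2 * (1 / x ^ 2 - 1 / x) = 1 - x := by
    field_simp
  have hx' : x ^ 2 * (1 / x ^ 2 - 1 / x) ≤ c := hx
  rw [hval] at hx'
  linarith

/-- **… `β_d` is not even FREQUENTLY bounded above at `0⁺`** (so `…K1WindowExactCriterion`'s weakest sufficient input fails for it too): for `0 < g ≤ 1∕2`,
`β_d 0 (g) = g⁻² − g⁻¹ ≥ g⁻²∕2 → ∞`. A MODEL, not Bałaban's β. [folklore] -/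
theorem not_frequently_le_invSq_sub_inv :
    ¬ ∃ b : ℝ, ∃ᶠ x in 𝓝[>] (0 : ℝ), ((fun (_k : ℕ) (v : Fin (_k + 1) → ℝ) => 1 / (v 0) ^ 2 - 1 / (v 0)) 0 (fun _ => x)) ≤ b := by
  rintro ⟨b, hfr⟩
  have hhalf : ∀ᶠ x in 𝓝[>] (0 : ℝ), x < 1 / 2 := (eventually_lt_nhds (by norm_num : (0 : ℝ) < 1 / 2)).filter_mono nhdsWithin_le_nhds
  have hpos : ∀ᶠ x in 𝓝[>] (0 : ℝ), 0 < x := eventually_mem_nhdsWithin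
  obtain ⟨x, hx, hxh, hx0, hM⟩ := (hfr.and_eventually (hhalf.and (hpos.and (eventually_le_one_div_sq_nhdsGT (2 * |b| + 2))))).exists
  have hx' : 1 / x ^ 2 - 1 / x ≤ b := hx
  have hy : 2 ≤ 1 / x := by
    rw [le_one_div (by norm_num : (0 : ℝ) < 2) hx0]
    exact hxh.le
  have hsq : 1 / x ^ 2 = (1 / x) ^ 2 := by rw [one_div_pow]
  rw [hsq] at hx' hM
  nlinarith [mul_nonneg (sub_nonneg.mpr hy) (by positivity : (0 : ℝ) ≤ 1 / x), abs_nonneg b, le_abs_self b]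

/-- ★ **… AND YET THE WINDOW OF `β_d` HOLDS**: `g⁻² − β_d 0 (g) = g⁻¹` exceeds every level eventually (hence frequently) at `0⁺`, so by the exact criterion
(`window_genSeq_iff_frequently_le`) the generated flow of `β_d` HAS the `K ≥ 1` window.  Hence the sufficient forms of record are NOT necessary: a window is compatible with
`g²β 0 (g) → 1⁻` and with a first β-function eventually unbounded above. A MODEL, not Bałaban's β. [cite: Balaban1987RG1, (0.17)–(0.20) pp.255–256 (elementary; sharpness of the bookkeeping)] -/
theorem window_genSeq_invSq_sub_inv :
    ∃ γ₁ : ℝ, 0 < γ₁ ∧ ∀ γ : ℝ, 0 < γ → γ ≤ γ₁ → ∃ P : B12.RunParams, 1 ≤ P.K ∧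
      Step.InInterval γ P.K (genSeq (fun (k : ℕ) (v : Fin (k + 1) → ℝ) => 1 / (v 0) ^ 2 - 1 / (v 0)) P.g0) := by
  rw [window_genSeq_iff_frequently_le]
  intro M
  refine ((eventually_le_one_div_nhdsGT M).mono fun x hx => ?_).frequently
  show M ≤ 1 / x ^ 2 - (1 / x ^ 2 - 1 / x)
  linarith

end Sharpness

/-! ## §3. The K-indexed window from the EXACT level-0 criterion plus upper box bounds at the levels `k ≥ 1` only -/

section WindowK

/-- Elementary: for positive `g`, `γ`, `γ⁻² ≤ g⁻²` gives `g ≤ γ`. [folklore] -/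
private theorem S_le_of_one_div_sq_le {g γ : ℝ} (hg : 0 < g) (hγ : 0 < γ) (h : 1 / γ ^ 2 ≤ 1 / g ^ 2) : g ≤ γ := by
  have h2 : g ^ 2 ≤ γ ^ 2 := (one_div_le_one_div (pow_pos hγ 2) (pow_pos hg 2)).1 h
  nlinarith [h2, hg, hγ]

/-- ★★ **THE LADDER.**  For a forward-generated construction (`DagBinding.ForwardGenerated C β`) whose β-family is bounded above by `β⁺` on the boxes `]0, γ₀]^{k+1}` AT THE LEVELS
`k ≥ 1` ONLY, and a bare coupling `g₀ ∈ ]0, γ]`, `γ ≤ γ₀`, whose FIRST STEP clears the gap `γ⁻² + K·B ≤ g₀⁻² − β 0 (g₀)` (`B := max β⁺ 0`): along the run `⟨K, m, g₀⟩` every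
coupling is positive and `≤ γ`, and `γ⁻² + (K − i)·B ≤ g_i⁻²` for `1 ≤ i ≤ K` (induction: the first step lands at `g_1⁻² = g₀⁻² − β 0 (g₀) ≥ γ⁻² + K·B`; afterwards the prefix lies
in the box, so (0.20) loses at most `B` per step).  Adapted from dag-n24-a's `Node00.N24_forwardGenerated_lower_bound` (level `0` there: the same box bound; here: the first-step gap).
[cite: Balaban1987RG1, (0.18)–(0.20) pp.255–256 and §1 p.264 («uniformly bounded», levels ≥ 1; elementary consequence)] -/
theorem ladder_of_forwardGenerated_of_firstStepGap_of_betaUpper_succ (C : B12.Construction) (β : HBeta) (hgen : ForwardGenerated C β) {βup γ₀ γ g₀ : ℝ}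
    (hhi : ∀ k : ℕ, 1 ≤ k → ∀ v, v ∈ Box γ₀ k → β k v ≤ βup) (hγ : 0 < γ) (hγ₀ : γ ≤ γ₀) (hg₀ : 0 < g₀) (hg₀γ : g₀ ≤ γ) (m K : ℕ)
    (hgap : 1 / γ ^ 2 + (K : ℝ) * max βup 0 ≤ 1 / g₀ ^ 2 - β 0 (fun _ => g₀)) :
    ∀ k, k ≤ K → ∀ i, i ≤ k →
      (0 < (C ⟨K, m, g₀⟩).flow.g i ∧ (C ⟨K, m, g₀⟩).flow.g i ≤ γ) ∧
        (1 ≤ i → 1 / γ ^ 2 + ((K : ℝ) - i) * max βup 0 ≤ 1 / ((C ⟨K, m, g₀⟩).flow.g i) ^ 2) := by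
  set B : ℝ := max βup 0 with hBdef
  have hB0 : 0 ≤ B := le_max_right _ _
  have hBup : βup ≤ B := le_max_left _ _
  have hγ2 : 0 < 1 / γ ^ 2 := by positivity
  set P : B12.RunParams := ⟨K, m, g₀⟩ with hPdef
  have hg0 : (C P).flow.g 0 = g₀ := hgen.1 P
  -- from the ladder bound at `i`, the coupling is `≤ γ`
  have hleγ : ∀ i : ℕ, i ≤ K → 0 < (C P).flow.g i → 1 / γ ^ 2 + ((K : ℝ) - i) * B ≤ 1 / ((C P).flow.g i) ^ 2 → (C P).flow.g i ≤ γ := by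
    intro i hi hpos hb
    have hle : 1 / γ ^ 2 ≤ 1 / ((C P).flow.g i) ^ 2 :=
      le_trans (le_add_of_nonneg_right (mul_nonneg (sub_nonneg.mpr (by exact_mod_cast hi)) hB0)) hb
    exact S_le_of_one_div_sq_le hpos hγ hle
  intro k
  induction k with
  | zero =>
    intro _ i hi
    obtain rfl : i = 0 := Nat.le_zero.mp hi
    rw [hg0]
    exact ⟨⟨hg₀, hg₀γ⟩, fun h => absurd h (by norm_num)⟩
  | succ k ih =>
    intro hk i hi
    have ih' := ih (Nat.le_of_succ_le hk)
    rcases Nat.lt_or_ge i (k + 1) with hlt | hge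
    · exact ih' i (Nat.lt_succ_iff.mp hlt)
    · obtain rfl : i = k + 1 := le_antisymm hi hge
      have hkK : k < K := Nat.lt_of_succ_le hk
      have hpos : ∀ j, j ≤ k → 0 < (C P).flow.g j := fun j hj => (ih' j hj).1.1
      have hKk : (0 : ℝ) ≤ (K : ℝ) - (k + 1 : ℕ) := by
        have : (k + 1 : ℕ) ≤ K := hk
        exact sub_nonneg.mpr (by exact_mod_cast this)
      -- the right side of (0.20) at step `k` dominates the next rung of the ladder
      have hrhs_ge : 1 / γ ^ 2 + ((K : ℝ) - (k + 1 : ℕ)) * B ≤ 1 / ((C P).flow.g k) ^ 2 - β k (prefixOf (C P).flow.g k) := by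
        rcases Nat.eq_zero_or_pos k with rfl | hk1
        · -- the FIRST step: the gap hypothesis
          have hpre : prefixOf (C P).flow.g 0 = fun _ => g₀ := by
            funext j
            rw [Subsingleton.elim (α := Fin 1) j 0]
            exact hg0
          rw [hpre, hg0]
          have : ((K : ℝ) - (0 + 1 : ℕ)) * B ≤ (K : ℝ) * B := by
            apply mul_le_mul_of_nonneg_right _ hB0
            push_cast; linarith
          linarith
        · -- a LATER step: the prefix lies in the box, the upper bound applies, the ladder at `k` feeds the ladder at `k + 1`
          have hbox : prefixOf (C P).flow.g k ∈ Box γ₀ k := by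
            rw [mem_box]
            intro j
            have hj : (j : ℕ) ≤ k := Nat.lt_succ_iff.mp j.isLt
            exact ⟨hpos j hj, ((ih' j hj).1.2).trans hγ₀⟩
          have hβle : β k (prefixOf (C P).flow.g k) ≤ B := (hhi k hk1 _ hbox).trans hBup
          have hbk : 1 / γ ^ 2 + ((K : ℝ) - k) * B ≤ 1 / ((C P).flow.g k) ^ 2 := (ih' k le_rfl).2 hk1
          have : ((K : ℝ) - (k + 1 : ℕ)) * B = ((K : ℝ) - k) * B - B := by push_cast; ring
          rw [this]
          linarith
      have hrhs : 0 < 1 / ((C P).flow.g k) ^ 2 - β k (prefixOf (C P).flow.g k) :=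
        lt_of_lt_of_le (by positivity) hrhs_ge
      obtain ⟨hposk1, heq⟩ := hgen.2 P k hkK hpos hrhs
      have hb : 1 / γ ^ 2 + ((K : ℝ) - (k + 1 : ℕ)) * B ≤ 1 / ((C P).flow.g (k + 1)) ^ 2 := by rw [heq]; exact hrhs_ge
      exact ⟨⟨hposk1, hleγ (k + 1) hk hposk1 hb⟩, fun _ => hb⟩

/-- ★★ **IN-INTERVAL RUNS OF EVERY LENGTH FROM THE EXACT LEVEL-0 CRITERION AND UPPER BOX BOUNDS AT THE LEVELS `k ≥ 1` ONLY.**  For a forward-generated construction with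
`∀ M, ∃ᶠ g in 𝓝[>] 0, M ≤ g⁻² − β 0 (g)` (level `0`: the exact criterion of `…K1WindowExactCriterion`, NOT a bound) and `β k ≤ β⁺` on `]0, γ₀]^{k+1}` for `k ≥ 1` ([I] p. 264): for
every `γ ∈ ]0, γ₀]`, every torus exponent `m` and EVERY `K`, some bare coupling `g₀ > 0` runs `⟨K, m, g₀⟩` inside `]0, γ]` (pick `g₀ < γ` with `g₀⁻² − β 0 (g₀) ≥ γ⁻² + K·max(β⁺,0)`,
frequently available; then the ladder).  Strictly weaker input than dag-n24-a's `Node00.N24_window_allK_of_forwardGenerated` (upper bound at every level incl. `0`).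
[cite: Balaban1987RG1, (0.18)–(0.20) pp.255–256 and §1 p.264 (elementary consequence)] -/
theorem windowK_of_forwardGenerated_of_frequently_le_of_betaUpper_succ (C : B12.Construction) (β : HBeta) (hgen : ForwardGenerated C β) {βup γ₀ γ : ℝ}
    (h0 : ∀ M : ℝ, ∃ᶠ x in 𝓝[>] (0 : ℝ), M ≤ 1 / x ^ 2 - β 0 (fun _ => x))
    (hhi : ∀ k : ℕ, 1 ≤ k → ∀ v, v ∈ Box γ₀ k → β k v ≤ βup) (hγ : 0 < γ) (hγ₀ : γ ≤ γ₀) (m K : ℕ) :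
    ∃ g0 : ℝ, 0 < g0 ∧ (C ⟨K, m, g0⟩).flow.InInterval γ K := by
  have hlt : ∀ᶠ x in 𝓝[>] (0 : ℝ), x < γ := (eventually_lt_nhds hγ).filter_mono nhdsWithin_le_nhds
  have hpos : ∀ᶠ x in 𝓝[>] (0 : ℝ), 0 < x := eventually_mem_nhdsWithin
  obtain ⟨g₀, hgap, hg₀lt, hg₀⟩ := ((h0 (1 / γ ^ 2 + (K : ℝ) * max βup 0)).and_eventually (hlt.and hpos)).exists
  refine ⟨g₀, hg₀, fun k hk => ?_⟩
  exact (ladder_of_forwardGenerated_of_firstStepGap_of_betaUpper_succ C β hgen hhi hγ hγ₀ hg₀ hg₀lt.le m K hgap k hk k le_rfl).1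

variable {F : T4Family} {G : Type*} [GaugeGroup G] [MeasurableSpace G] [HaarData G] in
/-- **The same at every finite-ε datum** (`D.fwd`), in `D.βfun` currency. [cite: Balaban1987RG1, (0.17)–(0.20) pp.255–256 and §1 p.264 (elementary consequence)] -/
theorem windowK_of_frequently_le_of_betaUpper_succ (D : FiniteEpsData F G) {βup γ₀ γ : ℝ}
    (h0 : ∀ M : ℝ, ∃ᶠ x in 𝓝[>] (0 : ℝ), M ≤ 1 / x ^ 2 - D.βfun 0 (fun _ => x))
    (hhi : ∀ k : ℕ, 1 ≤ k → ∀ v, v ∈ Box γ₀ k → D.βfun k v ≤ βup) (hγ : 0 < γ) (hγ₀ : γ ≤ γ₀) (m K : ℕ) :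
    ∃ g0 : ℝ, 0 < g0 ∧ (D.C ⟨K, m, g0⟩).flow.InInterval γ K :=
  windowK_of_forwardGenerated_of_frequently_le_of_betaUpper_succ D.C.toB12 D.βfun D.fwd h0 hhi hγ hγ₀ m K

end WindowK

/-! ### §3b. At NODE 00's Stage-13 datum: runs of every length from the level-0 germ condition + upper box bounds on the merged β at the levels `k ≥ 1` -/

section WindowKRecord

variable {F : T4Family} {N : ℕ} [NeZero N]

/-- FACE (every level): ON the box `]0, θ.γ]^{k+1}` the `k`-th β-function of record IS the merged one (`Node00.betaOfMerged_of_mem`; g0's `betaOfRecord₁₃_zero_const_of_le` is `k = 0`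
at constant histories). [cite: Balaban1987RG1, (1.20)–(1.22) p.264 and (2.9) p.266 (bookkeeping)] -/
theorem betaOfRecord₁₃_eq_betaMerged_of_mem_box (θ : Stage13HParams F N) {k : ℕ} {v : Fin (k + 1) → ℝ} (hv : v ∈ Box θ.γ k) :
    letI := θ.instVβ₁; letI := θ.instVβ₂; letI := θ.instιβ
    betaOfRecord₁₃ F N θ.toStage13Params k v =
      betaMerged F (mergedTermFamilyMatT F N (TcanOfRecord F N) (chiβOfRecord₁₃ F N θ.toStage13Params) θ.εbg) θ.ρ8 θ.bV k v := by
  letI := θ.instVβ₁; letI := θ.instVβ₂; letI := θ.instιβ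
  exact betaOfMerged_of_mem _ _ _ hv

/-- ★★ **AT THE STAGE-13 DATUM: IN-INTERVAL RUNS OF EVERY LENGTH `K` from the LEVEL-0 GERM CONDITION on the merged first β-function (`∀ M, ∃ᶠ g in 𝓝[>] 0, M ≤ g⁻² − β_m 0 (g)` —
exactly K1⁷'s window conjunct, by `…K1WindowExactCriterion`) AND the upper box bound `β_m k (v) ≤ β⁺` on `]0, γ₀]^{k+1}` AT THE LEVELS `k ≥ 1` ([I] p. 264 «uniformly bounded»,
levels ≥ 1; DISPLAYED, NODE O's), `0 < γ₀ ≤ θ.γ`**: for every `γ ∈ ]0, γ₀]`, `m`, `K` some `g₀ > 0` has `((datumOfRecord₁₃SepCoPH F N θ h).C ⟨K, m, g₀⟩).flow.InInterval γ K`.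
So, GIVEN K1⁷'s window conjunct, the extra price of runs of every length (the shape K2⁷'s `EndpointExistence` quantifies over) is the printed upper bound at the levels `k ≥ 1` alone.
[cite: Balaban1987RG1, (0.17)–(0.20) pp.255–256, Thm 2 p.259, (1.20)–(1.22) p.264 and §1 p.264; Balaban1989LargeFieldII, Thm 1 + (0.1) pp.355–356 (bookkeeping + elementary)] -/
theorem windowK_datumOfRecord₁₃SepCoPH_of_frequently_le_merged_of_betaMerged_upper_succ (θ : Stage13HParams F N) (h : θ.Provisos₁₃SepCoPH F N)
    (hγθ : 0 < θ.γ) {βup γ₀ : ℝ} (hγ₀θ : γ₀ ≤ θ.γ)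
    (h0 : ∀ M : ℝ, ∃ᶠ x in 𝓝[>] (0 : ℝ),
      M ≤ 1 / x ^ 2 -
        (letI := θ.instVβ₁; letI := θ.instVβ₂; letI := θ.instιβ
         betaMerged F (mergedTermFamilyMatT F N (TcanOfRecord F N) (chiβOfRecord₁₃ F N θ.toStage13Params) θ.εbg) θ.ρ8 θ.bV 0 (fun _ => x)))
    (hhi : ∀ k : ℕ, 1 ≤ k → ∀ v, v ∈ Box γ₀ k →
      (letI := θ.instVβ₁; letI := θ.instVβ₂; letI := θ.instιβ
       betaMerged F (mergedTermFamilyMatT F N (TcanOfRecord F N) (chiβOfRecord₁₃ F N θ.toStage13Params) θ.εbg) θ.ρ8 θ.bV k v) ≤ βup)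
    {γ : ℝ} (hγ : 0 < γ) (hγle : γ ≤ γ₀) (m K : ℕ) :
    ∃ g0 : ℝ, 0 < g0 ∧ ((datumOfRecord₁₃SepCoPH F N θ h).C ⟨K, m, g0⟩).flow.InInterval γ K := by
  letI := θ.instVβ₁; letI := θ.instVβ₂; letI := θ.instιβ
  refine windowK_of_frequently_le_of_betaUpper_succ (datumOfRecord₁₃SepCoPH F N θ h) (βup := βup) (γ₀ := γ₀) ?_ ?_ hγ hγle m K
  · intro M
    refine (h0 M).mp ?_
    filter_upwards [eventually_betaOfRecord₁₃_zero_eq_betaMerged θ hγθ] with x hx hM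
    show M ≤ 1 / x ^ 2 - betaOfRecord₁₃ F N θ.toStage13Params 0 (fun _ => x)
    rwa [hx]
  · intro k hk v hv
    show betaOfRecord₁₃ F N θ.toStage13Params k v ≤ βup
    rw [betaOfRecord₁₃_eq_betaMerged_of_mem_box θ (box_mono hγ₀θ k hv)]
    exact hhi k hk v hv

end WindowKRecord

end Summit.QuantumFields.YangMills.Theorems.BalabanUVNodesK1WindowSharpness

end
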